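import Mathlib
import Literature.Topology.FourManifolds.PlanarShadowWalk
import HarnessLib

/-!
# The ball target of the `F₂` shadow walk is obstructed by the subgroup generated by the letters

Topic `Literature/Topology/FourManifolds`, companion of `PlanarShadowWalk.lean`
(`Literature.Topology.FourManifolds.PlanarShadow`: `Move`, `Reachable`, `IsBallState`, `gx`, `gy`).
Fully proved, no definitions.

* `closure_eq_of_move`, `closure_eq_of_reachable` — the subgroup of `F₂` generated by the letters of a
  state is INVARIANT under signed Hurwitz moves (a move `(a, b) ↦ (a b a⁻¹, a)` or
  `(a, b) ↦ (b, b⁻¹ a b)` is a change of generators of the same subgroup).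
* `closure_eq_top_of_isBallState` — a ball state (two adjacent letters `c x c⁻¹, c y c⁻¹`) generates
  all of `F₂`.
* `closure_eq_top_of_reachable_isBallState` — hence a state whose letters generate a PROPER subgroup
  never walks to a ball.  (For the line `Sketch` of crux `ConvexBisection.PlanarAcyclicBisectionRigidity`,
  stmt-SmoothPoincare4-15086: this is why its lever `stub_shadowWalkK4` is settled through the DOUBLE
  target, `PlanarShadowDouble.lean`; the start states of the `s`/`t`-twin two-axis words of cyclic length
  18 generate proper subgroups — crux note `Negative-notes/ball-target-not-universal.md`.)
-/

namespace Literature.Topology.FourManifolds.PlanarShadow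

/-- The subgroup generated by the letters of a state. (Local shorthand in statements: we write the
closure out in full.) Two lists with the same members generate the same subgroup. [folklore] -/
theorem closure_congr_of_forall_mem {s t : List F₂} (h : ∀ g, g ∈ s ↔ g ∈ t) :
    Subgroup.closure {g | g ∈ s} = Subgroup.closure {g | g ∈ t} := by
  congr 1; ext g; exact h g

/-- **A signed Hurwitz move does not change the subgroup generated by the letters.** [folklore] -/
theorem closure_eq_of_move {s t : List F₂} (h : Move s t) :
    Subgroup.closure {g | g ∈ s} = Subgroup.closure {g | g ∈ t} := by
  -- both directions: every letter of one side lies in the closure of the other side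
  have key : ∀ (pre post : List F₂) (a b a' b' : F₂),
      a' ∈ Subgroup.closure ({a, b} : Set F₂) → b' ∈ Subgroup.closure ({a, b} : Set F₂) →
      Subgroup.closure {g | g ∈ pre ++ a' :: b' :: post} ≤ Subgroup.closure {g | g ∈ pre ++ a :: b :: post} := by
    intro pre post a b a' b' ha' hb'
    apply (Subgroup.closure_le _).2
    intro g hg
    simp only [Set.mem_setOf_eq, List.mem_append, List.mem_cons] at hg
    have hab : Subgroup.closure ({a, b} : Set F₂) ≤ Subgroup.closure {g | g ∈ pre ++ a :: b :: post} := by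
      apply (Subgroup.closure_le _).2
      intro u hu
      apply Subgroup.subset_closure
      simp only [Set.mem_insert_iff, Set.mem_singleton_iff] at hu
      simp only [Set.mem_setOf_eq, List.mem_append, List.mem_cons]
      rcases hu with rfl | rfl
      · exact Or.inr (Or.inl rfl)
      · exact Or.inr (Or.inr (Or.inl rfl))
    rcases hg with hg | rfl | rfl | hg
    · exact Subgroup.subset_closure (by simp [hg])
    · exact hab ha'
    · exact hab hb'
    · exact Subgroup.subset_closure (by simp [hg])
  have ma : ∀ a b : F₂, a ∈ Subgroup.closure ({a, b} : Set F₂) :=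
    fun a b => Subgroup.subset_closure (by simp)
  have mb : ∀ a b : F₂, b ∈ Subgroup.closure ({a, b} : Set F₂) :=
    fun a b => Subgroup.subset_closure (by simp)
  cases h with
  | hurwitz pre post a b =>
    apply le_antisymm
    · -- `b = a⁻¹ (a b a⁻¹) a`
      have hb : b ∈ Subgroup.closure ({a * b * a⁻¹, a} : Set F₂) := by
        have h0 : a⁻¹ * (a * b * a⁻¹) * a ∈ Subgroup.closure ({a * b * a⁻¹, a} : Set F₂) :=
          Subgroup.mul_mem _ (Subgroup.mul_mem _ (Subgroup.inv_mem _ (mb _ _)) (ma _ _)) (mb _ _)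
        have e : a⁻¹ * (a * b * a⁻¹) * a = b := by group
        rwa [e] at h0
      simpa using key pre post (a * b * a⁻¹) a a b (mb _ _) hb
    · exact key pre post a b (a * b * a⁻¹) a
        (Subgroup.mul_mem _ (Subgroup.mul_mem _ (ma _ _) (mb _ _)) (Subgroup.inv_mem _ (ma _ _))) (ma _ _)
  | hurwitzInv pre post a b =>
    apply le_antisymm
    · -- `a = b (b⁻¹ a b) b⁻¹`
      have ha : a ∈ Subgroup.closure ({b, b⁻¹ * a * b} : Set F₂) := by
        have h0 : b * (b⁻¹ * a * b) * b⁻¹ ∈ Subgroup.closure ({b, b⁻¹ * a * b} : Set F₂) :=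
          Subgroup.mul_mem _ (Subgroup.mul_mem _ (ma _ _) (mb _ _)) (Subgroup.inv_mem _ (ma _ _))
        have e : b * (b⁻¹ * a * b) * b⁻¹ = a := by group
        rwa [e] at h0
      simpa using key pre post b (b⁻¹ * a * b) a b ha (ma _ _)
    · exact key pre post a b b (b⁻¹ * a * b) (mb _ _)
        (Subgroup.mul_mem _ (Subgroup.mul_mem _ (Subgroup.inv_mem _ (mb _ _)) (ma _ _)) (mb _ _))

/-- **The subgroup generated by the letters is a walk invariant.** [folklore] -/
theorem closure_eq_of_reachable {s t : List F₂} (h : Reachable s t) :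
    Subgroup.closure {g | g ∈ s} = Subgroup.closure {g | g ∈ t} := by
  unfold Reachable at h
  induction h with
  | refl => rfl
  | tail _ hst ih =>
    rcases hst with hm | hm
    · exact ih.trans (closure_eq_of_move hm)
    · exact ih.trans (closure_eq_of_move hm).symm

/-- **A ball state generates `F₂`**: its letters contain `c x c⁻¹` and `c y c⁻¹`, which generate
`c F₂ c⁻¹ = F₂`. [folklore] -/
theorem closure_eq_top_of_isBallState {t : List F₂} (h : IsBallState t) :
    Subgroup.closure {g | g ∈ t} = ⊤ := by
  obtain ⟨c, pre, post, rfl⟩ := h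
  set H := Subgroup.closure {g | g ∈ pre ++ (c * gx * c⁻¹) :: (c * gy * c⁻¹) :: post} with hH
  have hx : c * gx * c⁻¹ ∈ H := Subgroup.subset_closure (by simp)
  have hy : c * gy * c⁻¹ ∈ H := Subgroup.subset_closure (by simp)
  -- the conjugate subgroup `c⁻¹ H c` contains the generators, hence is everything
  rw [eq_top_iff]
  intro g _
  have hgen : ∀ u : F₂, c * u * c⁻¹ ∈ H := by
    intro u
    induction u using FreeGroup.induction_on with
    | C1 => simp [H.one_mem]
    | of i =>
      fin_cases i
      · exact hx
      · exact hy
    | inv_of i ih =>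
      have : c * (FreeGroup.of i)⁻¹ * c⁻¹ = (c * FreeGroup.of i * c⁻¹)⁻¹ := by group
      rw [this]
      exact H.inv_mem ih
    | mul u v hu hv =>
      have : c * (u * v) * c⁻¹ = (c * u * c⁻¹) * (c * v * c⁻¹) := by group
      rw [this]
      exact H.mul_mem hu hv
  have : g = c * (c⁻¹ * g * c) * c⁻¹ := by group
  rw [this]
  exact hgen _

/-- **No walk from a state whose letters generate a proper subgroup reaches a ball.** [folklore] -/
theorem closure_eq_top_of_reachable_isBallState {s t : List F₂} (h : Reachable s t) (ht : IsBallState t) :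
    Subgroup.closure {g | g ∈ s} = ⊤ := by
  rw [closure_eq_of_reachable h, closure_eq_top_of_isBallState ht]

end Literature.Topology.FourManifolds.PlanarShadow
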